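import Literature.Probability.Percolation.TriUQuadArc
import HarnessLib

/-!
# Restricting crossings of the U-shaped region to a smaller outer scale

Topic `Literature/Probability/Percolation`; family `crit-perc`, statement **crit-perc.S16**
(`Literature.Probability.Percolation.triTheta_exponent`). Bookkeeping for the multiscale argument
(P. Nolin, EJP 13 (2008), §4.4, proof of Lemma 15 [arXiv 0711.4948: Lemma 14]: "If we look at
the crossing `c_{v₁}` in `U_{2^{i-2}N}^{1,ext}` …"): a crossing of `U_{k,N}` from the inner arc to
the outer boundary contains, as an initial segment, a crossing of `U_{k,N'}` for every smaller
outer scale `N' ≤ N` (`exists_uCross_restrict`), and the inner arcs agree (`uL_eq_uL`). So the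
canonical lowest crossings of the quad `uQuad k N'` apply to arms of the bigger region, and the
remainder of the arm joins the end of the initial segment to the far boundary.

## References

* P. Nolin, Near-critical percolation in two dimensions, *Electron. J. Probab.* 13 (2008), §4.4,
  proof of Lemma 15 [arXiv 0711.4948: Lemma 14] [Nolin2008].

## Mathlib / tree

Tree: `uL`, `uR`, `uSites`, `uInner`, `mem_coe_uSites`, `mem_uInner` (`TriUQuad.lean`),
`mem_uL_iff` (`TriUQuadArc.lean`), `PathIn.exit_or` (`SitePaths.lean`), `triGraph_adj_coord`.
-/

noncomputable section

open Set

namespace Literature.Probability.Percolation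

open LatticeModels

variable {k N N' : ℕ}

/-- The inner arc does not depend on the outer scale. [folklore] -/
theorem uL_eq_uL (hk : 1 ≤ k) (hkN : k + 1 ≤ N) (hkN' : k + 1 ≤ N') : uL k N = uL k N' := by
  ext z; rw [mem_uL_iff hk hkN, mem_uL_iff hk hkN']

/-- The smaller region lies in the bigger one. [folklore] -/
theorem uSites_subset_uSites (hN : N' ≤ N) : (↑(uSites k N') : Set (Site 2)) ⊆ ↑(uSites k N) := by
  intro z hz
  rw [mem_coe_uSites] at hz ⊢
  have : (N' : ℤ) ≤ N := by exact_mod_cast hN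
  exact ⟨⟨by omega, by omega, hz.1.2.2.1, by omega⟩, hz.2⟩

/-- **Restriction of a crossing to a smaller outer scale.** A `𝕋`-path of `U_{k,N} ∩ S` from a
site `a` of the inner arc to a site `b` of the outer boundary `uR k N` contains an initial segment
which is a path of `U_{k,N'} ∩ S` from `a` to a site `c` of `uR k N'`, and `c` is joined to `b`
inside `U_{k,N} ∩ S` (`k + 1 ≤ N' ≤ N`). [cite: Nolin2008, §4.4, proof of Lemma 15 (arXiv 0711.4948: Lemma 14)] -/
theorem exists_uCross_restrict (hk : 1 ≤ k) (hkN' : k + 1 ≤ N') (hN : N' ≤ N) {S : Set (Site 2)}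
    {a b : Site 2} (ha : a ∈ uL k N) (hb : b ∈ uR k N)
    (hp : PathIn triGraph ((↑(uSites k N) : Set (Site 2)) ∩ S) a b) :
    ∃ c ∈ uR k N', PathIn triGraph ((↑(uSites k N') : Set (Site 2)) ∩ S) a c ∧
      PathIn triGraph ((↑(uSites k N) : Set (Site 2)) ∩ S) c b := by
  have hkN : k + 1 ≤ N := hkN'.trans hN
  have hN'' : (N' : ℤ) ≤ N := by exact_mod_cast hN
  have hk' : (1 : ℤ) ≤ k := by exact_mod_cast hk
  have hkN'z : (k : ℤ) + 1 ≤ N' := by exact_mod_cast hkN'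
  have haU' : a ∈ (↑(uSites k N') : Set (Site 2)) := by
    rw [uL_eq_uL hk hkN hkN'] at ha; exact ha.1
  -- first exit from the smaller region
  rcases hp.exit_or (R := (↑(uSites k N') : Set (Site 2))) haU' with hin | ⟨c, d, hcU', hdU', hdA, hcd, hpre⟩
  · -- the whole path stays inside: then `b ∈ uR k N'`
    have hbU' : b ∈ (↑(uSites k N') : Set (Site 2)) := hin.right_mem.1
    refine ⟨b, ⟨hbU', ?_⟩, hin.mono fun z hz => ⟨hz.1, hz.2.2⟩, PathIn.refl hp.right_mem⟩
    obtain ⟨hbU, hb'⟩ := hb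
    rw [mem_coe_uSites] at hbU hbU'
    rcases hb' with h | h | h <;> omega
  · -- the exit site `c` is on the outer boundary of the smaller region
    have hc0 := triGraph_adj_coord hcd 0
    have hc1 := triGraph_adj_coord hcd 1
    have hcU := mem_coe_uSites.1 hcU'
    have hdU := mem_coe_uSites.1 hdA.1
    have hd' : ¬ ((-(N' : ℤ) ≤ d 0 ∧ d 0 ≤ N' ∧ 0 ≤ d 1 ∧ d 1 ≤ N')) := fun h => hdU' (mem_coe_uSites.2 ⟨h, hdU.2⟩)
    have hcR : c ∈ uR k N' := ⟨hcU', by push Not at hd'; omega⟩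
    refine ⟨c, hcR, hpre.mono fun z hz => ⟨hz.1, hz.2.2⟩, ?_⟩
    -- `c` is joined to `b`: the original path from `a` to `b` passes … we use connectivity through `a`
    exact ((hpre.mono fun z hz => hz.2).symm).trans hp

end Literature.Probability.Percolation
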